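import Literature.MathematicalPhysics.QuantumFieldTheory.Balaban1983to89.B9SitePinBlockCounts
import Literature.MathematicalPhysics.QuantumFieldTheory.Balaban1983to89.B9SiteKernelBlockMajorant
import Literature.MathematicalPhysics.QuantumFieldTheory.Balaban1983to89.B9PerturbationMajorantsAtLetters
import Literature.MathematicalPhysics.QuantumFieldTheory.Balaban1983to89.B9Thm31GpMajFromPinsPairM

/-!
# `Balaban1983to89.B9Proj349MajFromBlocks` — [B9] p. 421 *«It is easy to find estimates for the operator Δ′_π using Theorem 3.1 and the inequality
# (3.49)»*: THE (3.49) LETTER SCHEMA `Proj349Maj` OF THE Δ′_π MAJORANTS (rows 20–21) DERIVED FROM ROW 25's BLOCK-COMPLETE INPUTS — n06-i's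
# ALL-BLOCKS (3.49) kernel entries read as [4]-(2.51) block majorants of def-Y's model `PcoK` on the site pins, with `D_U ∕ D*_U` through
# node00-def-Y's carrier bridge

T. Bałaban, *Propagators for lattice gauge theories in a background field*, Commun. Math. Phys. **99** (1985) 389–434 [`Balaban1985BackgroundPropagators`,
"B9"]; [4] = T. Bałaban, *Propagators and renormalization transformations for lattice gauge theories. II*, Commun. Math. Phys. **96** (1984) 223–250
[`Balaban1984PropagatorsII`].  statement-level skeleton of published theorems with citation tags; proofs where landed; nothing here is a claim about
the Yang–Mills mass gap.

THE PRINT.  p. 399: *«These theorems [3.1, 3.2] imply all the properties of the operator R … For the operator P = I − R we obtain, using again Lemma 2.1,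
(3.49)»*; p. 421: *«It is easy to find estimates for the operator Δ′_π using Theorem 3.1 and the inequality (3.49)»*.

THE POINT (dag-n06-d ASK-3 Q2 for the N06 certificate).  After edition 23 the four Δ′_π majorants of rows 20–21 are derived from three per-letter schemas,
of which `h49 : Proj349Maj … (PcoK … (GpY …) U) (DvcoKH … U) (DvscoKH … U) …` ((3.49)₁₂₃ as block majorants, dag-n06-l `B9PerturbationMajorantAlgebra`)
is still DISPLAYED.  Row 25 holds (3.49) as KERNEL entries at the CARRIER blocks only (`Stmt349Printed` at `p349SiteY`) — not enough at members with
orphan blocks (dag-n06-l g3 memo) — but n06-i's derivation `B9Ineq349SiteFromBlocks.exists_threshold_349` bounds the entries at EVERY block pair from the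
block-complete inputs `Thm31SiteSchemas` (row 18's leaf) and `Thm32BlkSchema` (rows 15–16's display).  This file reads those all-blocks entries as block
majorants of def-Y's model:
* §1 ★★ `proj349Maj_of_allBlocks` — ONE member, one `U`: an all-blocks (3.49)-shaped bound (constant `C`, rate `θ`) + a level-faithful, 1-faithful,
  direction-blind `bI` + the near-block count `N₁` ⊢ `Proj349Maj (blkSK (sIK bI)) (blkBK bI) (PcoK … parS Gp U) (DvcoKH … U) (DvscoKH … U) R H
  ((d+1)·coordBound·basisBound·N₁·C·e^{2θ}) θ` (p0 by `B9SiteKernelBlockMajorant.hasMajorant_model₀` + `B9SitePinBlockCounts.fiber_sum_fineEntryS_le`;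
  p1 ∕ p2 by `hasMajorant_model₁ ∕ ₂` on the site carrier and node00-def-Y's `hasMajorantHom_DvcoKH_GcoS_of_compat ∕ …GcoS_DvscoKH_of_compat` through
  `GcoS P = (η²c)•PcoK`, `|c_f|η = 1` — the direction sum costs `d+1`);
* §2 ★★★ `proj349Maj_of_blockSchemas` — the FAMILY form: `Thm31SiteSchemas` + `Thm32BlkSchema` ⊢ `∃ M₃ a₀ CP δP, … ∀ x, M₃ ≤ M → ∀ α₀ > 0, Mα₀ ≤ a₀ →
  ∀ U, Reg335 c35 α₀ U → Proj349Maj … (PcoK … (𝔏 x).parS (𝔏 x).Gp U) … (R x) (H x) CP δP` with CLOSED `CP`, `δP = θ`; at def-Y's records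
  (`parS = parSymY`, `Gp = GpY … (parSymY …)` by `rfl`) it IS the knit's `h49`.
HONEST SCOPE.  Bookkeeping over landed objects; the two row-25 input schemas remain the certificate's displayed content (row 18's Theorem-3.7 leaf, rows
15–16's (3.48) display); nothing of [B9] or [4] asserted; count-neutral; N06 NOT discharged; one finite lattice at a time — nothing continuum ∕ ℝ⁴ ∕ OS ∕
mass gap ∕ Clay.  Cell `pub-ymgap` (HUMAN RULING D-0062), node N06 [B9], bundle F7 rows 20–21, seat `pub-ymgap-dag-n06-l` (g15), 2026-08-28.  NEW file; 0 `def`.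
-/

noncomputable section

namespace Literature.MathematicalPhysics.QuantumFieldTheory.Balaban1983to89.B9Proj349MajFromBlocks

open B6RandomWalk (HasMajorant)
open B6RandomWalkHom (HasMajorantHom hasMajorantHom_mono)
open B6Geom246MultiLevelBox (bset blkOf)
open B6GlobalChartV1 (PV blkV1)
open B6Ineq2142KLevelV1 (lvl β)
open B6KLevelCensusIndexV1 (KIdx)
open B9Thm34Ext (toB6)
open B9Ineq349SiteReading (fineEntryS)
open B9Ineq349SiteComposite (lenB distB lenB_pos etaS_pos)
open B9Ineq349SiteFromBlocks (exists_threshold_349 geo9Y_M_eq Thm31SiteSchemas Thm32BlkSchema)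
open B9CoReadingCoordsS (XSK blkSK sIK)
open B9PinMembersKLevelV1 (MemberY geo9Y bg9Y)
open B9GeoLemma21KLevelV1 (geo9Y_len_pos)
open Node00 (SiteY BlkY FBondY IBondY CfgY SiteOpY SiteParY CovLettersY etaS P349Y)
open Node00.OpsYSectDCoords (DvcoKH DvscoKH)
open Node00.OpsYNablaBridge (abs_cf_mul_etaS_of_hcfk hasMajorantHom_DvcoKH_GcoS_of_compat hasMajorantHom_GcoS_DvscoKH_of_compat)
open B9Thm31GpMajFromPinsPairM (compat_of_dirBlind)
open B9Thm39ReadingCoords (cR39 coordBound39 basisBound39)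
open B9CoReadingCoords (XBK blkBK coordOpK)
open B9CoReadingCoordsS (GcoS DcoS DscoS)
open B9PerturbationMajorantAlgebra (Proj349Maj)
open B9PerturbationMajorantsAtLetters (PcoK)
open B9SiteKernelBlockMajorant (hasMajorant_model₀ hasMajorant_model₁ hasMajorant_model₂)
open B9SitePinBlockCounts (fiber_sum_fineEntryS_le exists_card_nearBlocks_le pref4inv_zero pref4inv_one pref4inv_two)

variable {d ℓ : ℕ} {hd : 1 ≤ d + 1} {hL : Odd (ℓ + 1) ∧ 1 < ℓ + 1} {b₀ b₁ : ℝ} {Mstar : ℕ}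

/-! ## §1 `Proj349Maj` at one member and one configuration from the all-blocks (3.49) entries -/

section OneMember

variable {𝔸 : Type} [NormedRing 𝔸] [NormedAlgebra ℂ 𝔸] [CompleteSpace 𝔸] [FiniteDimensional ℝ 𝔸]
variable {κ : Type} [Fintype κ]

/-- scaling a two-space majorant by a non-negative scalar. [cite: Balaban1984PropagatorsII, (2.51)–(2.52) p.232, bookkeeping] -/
private theorem hasMajorantHom_smul {G₆ : B6.Geometry} {X Y : Type} {blkX : X → G₆.Site} {blkY : Y → G₆.Site} {T : (X → ℝ) →ₗ[ℝ] (Y → ℝ)}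
    {K : G₆.Site → G₆.Site → ℝ} (h : HasMajorantHom blkX blkY T K) {r : ℝ} (hr : 0 ≤ r) :
    HasMajorantHom blkX blkY (r • T) (fun a b => r * K a b) := by
  intro y' μ Bd hμ v
  rw [LinearMap.smul_apply, Pi.smul_apply, smul_eq_mul, abs_mul, abs_of_nonneg hr, mul_assoc]
  exact mul_le_mul_of_nonneg_left (h y' μ Bd hμ v) hr

open Classical in
/-- ★★ **(3.49)₁₂₃ AS BLOCK MAJORANTS OF THE LETTER MODEL — ONE MEMBER, ONE CONFIGURATION**: from an ALL-BLOCKS (3.49)-shaped bound of the entries of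
`P = P349Y parS G′` at `U` (constant `C`, rate `θ`; n06-i `exists_threshold_349`), a level-faithful, 1-faithful and direction-blind site pin `bI` and the
near-block count `N₁`: the schema `Proj349Maj` of rows 20–21 for the model `PcoK` with def-Y's `DvcoKH ∕ DvscoKH` between the site carrier
`blkSK (sIK bI)` and the bond carrier `blkBK bI`, constant `(d+1)·coordBound·basisBound·N₁·C·e^{2θ}`, rate `θ` (p0 by `hasMajorant_model₀`; p1∕p2 by
`hasMajorant_model₁∕₂` on the site carrier and node00-def-Y's compatible transfers through `GcoS = (η²c)•PcoK`, `|c_f|η = 1`).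
[cite: Balaban1985BackgroundPropagators, (3.49) p.399 + p.421 («using … the inequality (3.49)»), (3.3) p.390, (3.8) p.392; Balaban1984PropagatorsII, (2.51)–(2.52) p.232] -/
theorem proj349Maj_of_allBlocks (x : MemberY d ℓ hd hL b₀ b₁ Mstar) [Fintype (geo9Y x).Site] (b : Module.Basis κ ℝ 𝔸) (hc : 0 < cR39 b)
    {G : Subgroup 𝔸ˣ}
    (parS : SiteParY 𝔸 x.toKIdx) (Gp : SiteOpY 𝔸 x.toKIdx) (U : CfgY 𝔸 x.toKIdx)
    {bI : FBondY x.toKIdx → IBondY x.toKIdx} (hbI0 : ∀ f : FBondY x.toKIdx, bI f = bI ⟨f.src, 0⟩)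
    (hlev : ∀ f : FBondY x.toKIdx, lvl x.hN x.D x.hk (bI f) = (blkV1 x.hN x.D f).1.1)
    (hβ1 : ∀ f : FBondY x.toKIdx, (B6Geom246MultiLevelTorus.geomT x.D).dist (β x.hN x.D x.hk (bI f)) (blkV1 x.hN x.D f) ≤ 1)
    {N₁ : ℝ} (hN₁0 : 0 ≤ N₁)
    (hN₁ : ∀ s₀ : BlkY x.toKIdx, ((Finset.univ.filter fun s : BlkY x.toKIdx => distB x.toKIdx s₀ s ≤ 1).card : ℝ) ≤ N₁)
    {C θ : ℝ} (hC : 0 ≤ C) (hθ : 0 ≤ θ)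
    (hP : ∀ (n : Fin 4) (s s' : BlkY x.toKIdx), fineEntryS x.toKIdx (P349Y x.toKIdx parS Gp) U s s' n ≤
      C * B9.pref4inv (lenB x.toKIdx s) n * lenB x.toKIdx s' ^ (-((d + 1 : ℕ) : ℝ)) * Real.exp (-(θ * distB x.toKIdx s s')))
    (R : ℝ) (H : Prop) :
    Proj349Maj (g := geo9Y x) (blkSK x.toKIdx (sIK x.toKIdx bI)) (blkBK x.toKIdx bI)
      (PcoK x.toKIdx b (bg9Y 𝔸 G x) (fun U => U) parS Gp U) (DvcoKH x.toKIdx b (bg9Y 𝔸 G x) (fun U => U) U)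
      (DvscoKH x.toKIdx b (bg9Y 𝔸 G x) (fun U => U) U) R H
      (((d + 1 : ℕ) : ℝ) * (coordBound39 b * basisBound39 b * N₁ * C * Real.exp (2 * θ))) θ := by
  set CP := coordBound39 b * basisBound39 b * N₁ * C * Real.exp (2 * θ) with hCP
  have hcb : 0 ≤ coordBound39 b := norm_nonneg _
  have hbb : 0 ≤ basisBound39 b := Finset.sum_nonneg fun _ _ => norm_nonneg _
  have hCP0 : 0 ≤ CP := by rw [hCP]; positivity
  have hd1 : (1 : ℝ) ≤ ((d + 1 : ℕ) : ℝ) := by exact_mod_cast Nat.succ_le_succ (Nat.zero_le d)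
  have hCPle : CP ≤ ((d + 1 : ℕ) : ℝ) * CP := le_mul_of_one_le_left hCP0 hd1
  have hcf : |x.cf| * etaS x.toKIdx = 1 := abs_cf_mul_etaS_of_hcfk x.toKIdx x.hcfk
  have hSB := compat_of_dirBlind (κ := κ) x.toKIdx hbI0
  have hη2c : 0 < etaS x.toKIdx ^ 2 * cR39 b := mul_pos (pow_pos (etaS_pos _) 2) hc
  -- the counting inequality at the three entries
  have hcnt := fun (n : Fin 4) (z : SiteY x.toKIdx) (y' : IBondY x.toKIdx) =>
    mul_le_mul_of_nonneg_left (fiber_sum_fineEntryS_le x hlev hβ1 hN₁ (P349Y x.toKIdx parS Gp) U hC hθ hP n z y')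
      (mul_nonneg hcb hbb)
  -- the model identities: `PcoK = coordOpK (P)`, `GcoS P = (η²c) • PcoK`
  have hPco : PcoK x.toKIdx b (bg9Y 𝔸 G x) (fun U => U) parS Gp U =
      coordOpK b (fun _ : Fin (d + 1) => (P349Y x.toKIdx parS Gp U).restrictScalars ℝ) := rfl
  have hGco : GcoS x.toKIdx b (bg9Y 𝔸 G x) (fun U => U) (P349Y x.toKIdx parS Gp) U =
      (etaS x.toKIdx ^ 2 * cR39 b) • PcoK x.toKIdx b (bg9Y 𝔸 G x) (fun U => U) parS Gp U := rfl
  have hinv : (etaS x.toKIdx ^ 2 * cR39 b)⁻¹ * (|x.cf| * etaS x.toKIdx * (etaS x.toKIdx ^ 2 * cR39 b)) = 1 := by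
    rw [hcf, one_mul, inv_mul_cancel₀ hη2c.ne']
  -- the kernel of the two derivative entries on the site carrier
  set K₁ : (geo9Y x).Site → (geo9Y x).Site → ℝ := fun a a' => CP * ((geo9Y x).len a)⁻¹ * Real.exp (-(θ * (geo9Y x).dist a a')) with hK₁
  have hK₁le : ∀ a a', K₁ a a' ≤ ((d + 1 : ℕ) : ℝ) * CP * ((geo9Y x).len a)⁻¹ * Real.exp (-(θ * (geo9Y x).dist a a')) := fun a a' => by
    rw [hK₁]
    exact mul_le_mul_of_nonneg_right (mul_le_mul_of_nonneg_right hCPle (inv_nonneg.2 (geo9Y_len_pos x a).le)) (Real.exp_nonneg _)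
  -- one decidability instance for the fibres on both sides (the index bonds ARE the sites of the reading geometry)
  letI : DecidableEq (toB6 (geo9Y x) R H).Site := inferInstanceAs (DecidableEq (IBondY x.toKIdx))
  refine ⟨?_, ?_, ?_⟩
  · -- p0: the letter itself
    rw [hPco]
    refine hasMajorant_model₀ (g := toB6 (geo9Y x) R H) x.toKIdx b (bg9Y 𝔸 G x) (fun U => U) (P349Y x.toKIdx parS Gp) (sIK x.toKIdx bI) U fun z y' => ?_
    have h := hcnt 0 z y'
    rw [pref4inv_zero, mul_one] at h
    refine h.trans ?_
    calc coordBound39 b * basisBound39 b * (N₁ * C * Real.exp (2 * θ) * Real.exp (-(θ * (geo9Y x).dist (sIK x.toKIdx bI z) y')))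
        = CP * Real.exp (-(θ * (geo9Y x).dist (sIK x.toKIdx bI z) y')) := by rw [hCP]; ring
      _ ≤ ((d + 1 : ℕ) : ℝ) * CP * Real.exp (-(θ * (geo9Y x).dist (sIK x.toKIdx bI z) y')) :=
          mul_le_mul_of_nonneg_right hCPle (Real.exp_nonneg _)
  · -- p1: `D_U P` — the site-carrier composite `DcoS ∘ PcoK`, then def-Y's compatible transfer through `GcoS P = (η²c)•PcoK`
    have h1 : HasMajorantHom (g := toB6 (geo9Y x) R H) (blkSK x.toKIdx (sIK x.toKIdx bI)) (blkSK x.toKIdx (sIK x.toKIdx bI))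
        (DcoS x.toKIdx b (bg9Y 𝔸 G x) (fun U => U) U ∘ₗ PcoK x.toKIdx b (bg9Y 𝔸 G x) (fun U => U) parS Gp U) K₁ := by
      rw [hPco]
      refine hasMajorant_model₁ (g := toB6 (geo9Y x) R H) x.toKIdx b (bg9Y 𝔸 G x) (fun U => U) (P349Y x.toKIdx parS Gp) (sIK x.toKIdx bI) U fun z y' => ?_
      have h := hcnt 1 z y'
      rw [pref4inv_one] at h
      refine h.trans (le_of_eq ?_)
      rw [hK₁, hCP]; ring
    have h2 : HasMajorantHom (g := toB6 (geo9Y x) R H) (blkSK x.toKIdx (sIK x.toKIdx bI)) (blkSK x.toKIdx (sIK x.toKIdx bI))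
        (DcoS x.toKIdx b (bg9Y 𝔸 G x) (fun U => U) U ∘ₗ GcoS x.toKIdx b (bg9Y 𝔸 G x) (fun U => U) (P349Y x.toKIdx parS Gp) U)
        (fun a a' => (etaS x.toKIdx ^ 2 * cR39 b) * K₁ a a') := by
      rw [hGco, LinearMap.comp_smul]
      exact hasMajorantHom_smul h1 hη2c.le
    have h3 := hasMajorantHom_DvcoKH_GcoS_of_compat x.toKIdx b (bg9Y 𝔸 G x) (fun U => U) (P349Y x.toKIdx parS Gp) hSB U h2
    have h4 : DvcoKH x.toKIdx b (bg9Y 𝔸 G x) (fun U => U) U ∘ₗ PcoK x.toKIdx b (bg9Y 𝔸 G x) (fun U => U) parS Gp U =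
        (etaS x.toKIdx ^ 2 * cR39 b)⁻¹ •
          (DvcoKH x.toKIdx b (bg9Y 𝔸 G x) (fun U => U) U ∘ₗ GcoS x.toKIdx b (bg9Y 𝔸 G x) (fun U => U) (P349Y x.toKIdx parS Gp) U) := by
      rw [hGco, LinearMap.comp_smul, smul_smul, inv_mul_cancel₀ hη2c.ne', one_smul]
    rw [h4]
    refine hasMajorantHom_mono _ _ (hasMajorantHom_smul h3 (inv_nonneg.2 hη2c.le)) fun a a' => ?_
    calc (etaS x.toKIdx ^ 2 * cR39 b)⁻¹ * (|x.cf| * etaS x.toKIdx * ((etaS x.toKIdx ^ 2 * cR39 b) * K₁ a a'))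
        = ((etaS x.toKIdx ^ 2 * cR39 b)⁻¹ * (|x.cf| * etaS x.toKIdx * (etaS x.toKIdx ^ 2 * cR39 b))) * K₁ a a' := by ring
      _ = K₁ a a' := by rw [hinv, one_mul]
      _ ≤ _ := hK₁le a a'
  · -- p2: `P D*_U` — `PcoK ∘ DscoS` on the site carrier, then the compatible transfer (the direction sum costs `d+1`)
    have h1 : HasMajorantHom (g := toB6 (geo9Y x) R H) (blkSK x.toKIdx (sIK x.toKIdx bI)) (blkSK x.toKIdx (sIK x.toKIdx bI))
        (PcoK x.toKIdx b (bg9Y 𝔸 G x) (fun U => U) parS Gp U ∘ₗ DscoS x.toKIdx b (bg9Y 𝔸 G x) (fun U => U) U) K₁ := by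
      rw [hPco]
      refine hasMajorant_model₂ (g := toB6 (geo9Y x) R H) x.toKIdx b (bg9Y 𝔸 G x) (fun U => U) (P349Y x.toKIdx parS Gp) (sIK x.toKIdx bI) U fun z y' => ?_
      have h := hcnt 2 z y'
      rw [pref4inv_two] at h
      refine h.trans (le_of_eq ?_)
      rw [hK₁, hCP]; ring
    have h2 : HasMajorantHom (g := toB6 (geo9Y x) R H) (blkSK x.toKIdx (sIK x.toKIdx bI)) (blkSK x.toKIdx (sIK x.toKIdx bI))
        (GcoS x.toKIdx b (bg9Y 𝔸 G x) (fun U => U) (P349Y x.toKIdx parS Gp) U ∘ₗ DscoS x.toKIdx b (bg9Y 𝔸 G x) (fun U => U) U)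
        (fun a a' => (etaS x.toKIdx ^ 2 * cR39 b) * K₁ a a') := by
      rw [hGco, LinearMap.smul_comp]
      exact hasMajorantHom_smul h1 hη2c.le
    have h3 := hasMajorantHom_GcoS_DvscoKH_of_compat x.toKIdx b (bg9Y 𝔸 G x) (fun U => U) (P349Y x.toKIdx parS Gp) hSB U h2
    have h4 : PcoK x.toKIdx b (bg9Y 𝔸 G x) (fun U => U) parS Gp U ∘ₗ DvscoKH x.toKIdx b (bg9Y 𝔸 G x) (fun U => U) U =
        (etaS x.toKIdx ^ 2 * cR39 b)⁻¹ •
          (GcoS x.toKIdx b (bg9Y 𝔸 G x) (fun U => U) (P349Y x.toKIdx parS Gp) U ∘ₗ DvscoKH x.toKIdx b (bg9Y 𝔸 G x) (fun U => U) U) := by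
      rw [hGco, LinearMap.smul_comp, smul_smul, inv_mul_cancel₀ hη2c.ne', one_smul]
    rw [h4]
    refine hasMajorantHom_mono _ _ (hasMajorantHom_smul h3 (inv_nonneg.2 hη2c.le)) fun a a' => le_of_eq ?_
    calc (etaS x.toKIdx ^ 2 * cR39 b)⁻¹ * (((d + 1 : ℕ) : ℝ) * (|x.cf| * etaS x.toKIdx) * ((etaS x.toKIdx ^ 2 * cR39 b) * K₁ a a'))
        = ((d + 1 : ℕ) : ℝ) * (((etaS x.toKIdx ^ 2 * cR39 b)⁻¹ * (|x.cf| * etaS x.toKIdx * (etaS x.toKIdx ^ 2 * cR39 b))) * K₁ a a') := by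
          ring
      _ = ((d + 1 : ℕ) : ℝ) * K₁ a a' := by rw [hinv, one_mul]
      _ = _ := by rw [hK₁]; ring

end OneMember

/-! ## §2 The family statement: `Proj349Maj` at every member above a threshold from the block-complete Thm 3.1 ∕ Thm 3.2-type schemas -/

section Family

variable {𝔸 : Type} [NormedRing 𝔸] [NormedAlgebra ℂ 𝔸] [CompleteSpace 𝔸] [FiniteDimensional ℝ 𝔸]
variable {κ : Type} [Fintype κ]
variable [∀ x : MemberY d ℓ hd hL b₀ b₁ Mstar, Fintype (geo9Y x).Site]

open Classical in
/-- ★★★ **(3.49)₁₂₃ FOR `P = I − R(U)` AS THE BLOCK-MAJORANT SCHEMA `Proj349Maj` OF ROWS 20–21, EVERY MEMBER ABOVE A THRESHOLD, FROM THE BLOCK-COMPLETE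
THM-3.1 ∕ THM-3.2-TYPE INPUTS OF ROW 25** (n06-i `Thm31SiteSchemas` — from row 18's Theorem-3.7 leaf — and `Thm32BlkSchema` — from rows 15–16's `(3.48)⁻¹`
display): n06-i's ALL-BLOCKS derivation `exists_threshold_349` («using again Lemma 2.1»), the block count of §1 ([4] (2.61) on the block torus), the fibre
sums of §2 and node00-def-Y's compatible transfers; the index-bond map `bI` is level-faithful, 1-faithful and direction-blind; constants CLOSED
(`CP = (d+1)·coordBound·basisBound·N₁·B₀B₁B₀C_g·e^{2θ}`, `δP = θ`), thresholds merged by `max ∕ min`.  At def-Y's records `(𝔏 x).parS = parSymY`,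
`(𝔏 x).Gp = GpY … (parSymY …)` by `rfl`, so this IS the `h49` binder of dag-n06-d's edition 23.
[cite: Balaban1985BackgroundPropagators, (3.49) p.399 («These theorems [3.1, 3.2] imply … using again Lemma 2.1»), p.421 («using … the inequality (3.49)»); Balaban1984PropagatorsII, (2.51)–(2.52) p.232, Lemma 2.1 (2.61) p.234] -/
theorem proj349Maj_of_blockSchemas (b : Module.Basis κ ℝ 𝔸) (hc : 0 < cR39 b) {G : Subgroup 𝔸ˣ} {c35 : ℝ}
    (𝔏 : ∀ x : MemberY d ℓ hd hL b₀ b₁ Mstar, CovLettersY 𝔸 x)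
    (h31S : Thm31SiteSchemas 𝔸 G c35 𝔏) (h32 : Thm32BlkSchema 𝔸 G c35 𝔏)
    {bI : ∀ x : MemberY d ℓ hd hL b₀ b₁ Mstar, FBondY x.toKIdx → IBondY x.toKIdx}
    (hbI0 : ∀ (x : MemberY d ℓ hd hL b₀ b₁ Mstar) (f : FBondY x.toKIdx), bI x f = bI x ⟨f.src, 0⟩)
    (hlev : ∀ (x : MemberY d ℓ hd hL b₀ b₁ Mstar) (f : FBondY x.toKIdx), lvl x.hN x.D x.hk (bI x f) = (blkV1 x.hN x.D f).1.1)
    (hβ1 : ∀ (x : MemberY d ℓ hd hL b₀ b₁ Mstar) (f : FBondY x.toKIdx),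
      (B6Geom246MultiLevelTorus.geomT x.D).dist (β x.hN x.D x.hk (bI x f)) (blkV1 x.hN x.D f) ≤ 1)
    (R : MemberY d ℓ hd hL b₀ b₁ Mstar → ℝ) (H : MemberY d ℓ hd hL b₀ b₁ Mstar → Prop) :
    ∃ M₃ a₀ CP δP : ℝ, 0 < M₃ ∧ 0 < a₀ ∧ 0 ≤ CP ∧ 0 < δP ∧
      ∀ x : MemberY d ℓ hd hL b₀ b₁ Mstar, M₃ ≤ (geo9Y x).M → ∀ α₀ : ℝ, 0 < α₀ → (geo9Y x).M * α₀ ≤ a₀ →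
        ∀ U : (bg9Y 𝔸 G x).Cfg, (bg9Y 𝔸 G x).Reg335 c35 α₀ U →
          Proj349Maj (g := geo9Y x) (blkSK x.toKIdx (sIK x.toKIdx (bI x))) (blkBK x.toKIdx (bI x))
            (PcoK x.toKIdx b (bg9Y 𝔸 G x) (fun U => U) (𝔏 x).parS (𝔏 x).Gp U)
            (DvcoKH x.toKIdx b (bg9Y 𝔸 G x) (fun U => U) U) (DvscoKH x.toKIdx b (bg9Y 𝔸 G x) (fun U => U) U) (R x) (H x) CP δP := by
  obtain ⟨M₁, δ₀, a₁, B₀, hM₁, hδ₀, ha₁, hB₀, h1⟩ := h31S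
  obtain ⟨M₂, δ₁, a₂, B₁, hM₂, hδ₁, ha₂, hB₁, h2⟩ := h32
  obtain ⟨M₃, θ, Cg, hM₃, hθ, hCg, -, h349⟩ := exists_threshold_349 (d := d) (ℓ := ℓ) (hd := hd) (hL := hL) (b₀ := b₀) (b₁ := b₁) hδ₀ hδ₁
  obtain ⟨ML, N₁, hN₁0, hN⟩ := exists_card_nearBlocks_le (d := d) (ℓ := ℓ) (hd := hd) (hL := hL) (b₀ := b₀) (b₁ := b₁) (Mstar := Mstar)
  set C : ℝ := B₀ * B₁ * B₀ * Cg with hC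
  have hC0 : 0 ≤ C := by rw [hC]; positivity
  have hcb : 0 ≤ coordBound39 b := norm_nonneg _
  have hbb : 0 ≤ basisBound39 b := Finset.sum_nonneg fun _ _ => norm_nonneg _
  refine ⟨max (max M₁ M₂) (max M₃ ML), min a₁ a₂,
    ((d + 1 : ℕ) : ℝ) * (coordBound39 b * basisBound39 b * N₁ * C * Real.exp (2 * θ)), θ,
    lt_of_lt_of_le hM₁ ((le_max_left _ _).trans (le_max_left _ _)), lt_min ha₁ ha₂, by positivity, hθ,
    fun x hM α₀ hα₀ hMa U hU => ?_⟩
  have hM1 : M₁ ≤ (geo9Y x).M := ((le_max_left _ _).trans (le_max_left _ _)).trans hM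
  have hM2 : M₂ ≤ (geo9Y x).M := ((le_max_right _ _).trans (le_max_left _ _)).trans hM
  have hM3 : M₃ ≤ (geo9Y x).M := ((le_max_left _ _).trans (le_max_right _ _)).trans hM
  have hML : ML ≤ (geo9Y x).M := ((le_max_right _ _).trans (le_max_right _ _)).trans hM
  have hMa1 : (geo9Y x).M * α₀ ≤ a₁ := hMa.trans (min_le_left _ _)
  have hMa2 : (geo9Y x).M * α₀ ≤ a₂ := hMa.trans (min_le_right _ _)
  obtain ⟨hL, hR⟩ := h1 x hM1 α₀ hα₀ hMa1 U hU
  have hB := h2 x hM2 α₀ hα₀ hMa2 U hU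
  have hM3' : M₃ ≤ ((ℓ : ℝ) + 1) * x.Mh := (geo9Y_M_eq x) ▸ hM3
  have hP := h349 x.toKIdx hM3' (𝔏 x).parS (𝔏 x).Gp U hB₀.le hB₁.le hL hR hB
  exact proj349Maj_of_allBlocks x b hc (𝔏 x).parS (𝔏 x).Gp U (hbI0 x) (hlev x) (hβ1 x) hN₁0 (hN x hML) hC0 hθ.le hP (R x) (H x)

end Family

end Literature.MathematicalPhysics.QuantumFieldTheory.Balaban1983to89.B9Proj349MajFromBlocks

end
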